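import Summits.BirchSwinnertonDyer.BirchSwinnertonDyer.Theorems.PrintCFramBottomClassIndexLawFiveLeFlipRungTwoOddCut
import Literature.NumberTheory.EllipticCurves.HalfIntegralWeightClassProjection
import HarnessLib

/-!
# Crux `PrintCFram.BottomClassIndexLawFiveLe` (stmt-BirchSwinnertonDyer-20372), line `eisenstein-resource-bdp-line` (registry v29/v30a `stub_flipRungTwo`):
# THE 2-ADIC FLIPPED-CUSP RUNG, modular assembly piece (A0) — TUNNELL'S CLASS PROJECTION PRESERVES `M_{k/2}` AT EVERY LEVEL
# (cell `bsd-print-cfram`, width seat `bsd-line-cfram-p1-w7` g9; THEOREMS ONLY, `--supports` 20372 `--as helper`; BSD is not proved by any of this)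

HONEST FRAMING. Nothing here is a statement about BSD; no registered stub is closed. The Literature's `classProj_mem_halfIntModularForms` is stated at
Tunnell's level `128`; the 2-adic rung needs `P_c g ∈ M_{(2k+1)/2}` for `g` of level `4Q₀²`. w7 g8's planned copy-edit (P2, `…FlipRungTwoTranslationLevel`,
p713693) bounced on elaboration errors and is SUPERSEDED by this 1-step corollary of (M1) `…FlipRungTwoOddCut.sqClassAverage_mem_halfIntModularForms`:
`P_c g = Σ_{t mod 8} ⅛ζ₈^{−ct} g(· + t/8)` is a translate average whose weights are square-class invariant FOR FREE, because every unit `u` of `ℤ/8`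
has `u² = 1`. Hence **`classProj_mem_halfIntModularForms_of_mem`**: `g ∈ M_{K/2}(N, χ)`, `4 ∣ N` ⟹ `P_c g ∈ M_{K/2}(64N, χ)` (any `K`, any `χ`).

No definitions, no named facts, no `sorry`. beyond-print theorem: NO. References: [Shimura1973HalfIntegral] §1, Prop. 1.5; [Tunnell1983Congruent] p. 328.
-/

set_option autoImplicit false
-- summit-side namespace `Summit.BirchSwinnertonDyer.BirchSwinnertonDyer.…` (single-conjunct summit, D-0017 layout)
set_option linter.dupNamespace false

noncomputable section

open UpperHalfPlane hiding I
open Complex CongruenceSubgroup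
open scoped MatrixGroups Real
open Literature.NumberTheory.EllipticCurves.ModularForms
open Literature.NumberTheory.EllipticCurves.Tunnell1983 (zeta8 classProj classProj_apply)

namespace Summit.BirchSwinnertonDyer.BirchSwinnertonDyer.Theorems.PrintCFram.FlipRung

/-- Every unit of `ℤ/8` squares to `1`. [folklore] -/
theorem sq_eq_one_of_isUnit_zmod_eight (u : ZMod 8) (hu : IsUnit u) : u ^ 2 = 1 := by
  revert hu
  decide +revert

/-- The class projection as a translate average over `ℤ/8` (the shape of (M1) `sqClassAverage_mem_halfIntModularForms`). [folklore] -/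
theorem classProj_eq_sum_zmod (c : ℕ) (g : ℍ → ℂ) :
    classProj c g = fun z : ℍ ↦ ∑ t : ZMod 8, ((8 : ℂ)⁻¹ * (zeta8 ^ (c * t.val))⁻¹) *
      g (((((t.val : ℝ) / ((8 : ℕ) : ℝ) : ℝ)) +ᵥ z : ℍ)) := by
  funext z
  rw [classProj_apply]
  have h : ∀ j : ℕ, ((((j : ℝ) * 8⁻¹ : ℝ)) +ᵥ z : ℍ) = ((((j : ℝ) / ((8 : ℕ) : ℝ) : ℝ)) +ᵥ z : ℍ) := fun j ↦ by
    push_cast; rw [div_eq_mul_inv]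
  simp_rw [h]
  exact (Fin.sum_univ_eq_sum_range (fun j : ℕ ↦ (8 : ℂ)⁻¹ * (zeta8 ^ (c * j))⁻¹ *
    g ((((j : ℝ) / ((8 : ℕ) : ℝ) : ℝ)) +ᵥ z : ℍ)) 8).symm

/-- **THE CLASS PROJECTION PRESERVES `M_{K/2}` AT EVERY LEVEL**: for `g ∈ M_{K/2}(N, χ)` with `4 ∣ N` and any class `c`,
`P_c g ∈ M_{K/2}(64·N, χ)` ((M1) with `Q = 8`; the weights `⅛ζ₈^{−ct}` are square-class invariant since `u² = 1` for every unit `u` mod `8`).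
[cite: Shimura1973HalfIntegral, §1, Prop. 1.5] [cite: Tunnell1983Congruent, p. 328] -/
theorem classProj_mem_halfIntModularForms_of_mem {K N : ℕ} (hN : 4 ∣ N) {χ : DirichletCharacter ℂ N} {g : ℍ → ℂ}
    (hg : g ∈ halfIntModularForms K N χ) (c : ℕ) :
    classProj c g ∈ halfIntModularForms K (N * 8 ^ 2) (DirichletCharacter.changeLevel (dvd_mul_right N (8 ^ 2)) χ) := by
  rw [classProj_eq_sum_zmod]
  refine sqClassAverage_mem_halfIntModularForms hN hg _ (fun u t hu ↦ ?_)
  rw [sq_eq_one_of_isUnit_zmod_eight u hu, one_mul]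

/-- The same with the trivial character spelled as `1` at the new level. [cite: Shimura1973HalfIntegral, §1, Prop. 1.5] -/
theorem classProj_mem_halfIntModularForms_one {K N : ℕ} (hN : 4 ∣ N) {g : ℍ → ℂ}
    (hg : g ∈ halfIntModularForms K N (1 : DirichletCharacter ℂ N)) (c : ℕ) :
    classProj c g ∈ halfIntModularForms K (N * 8 ^ 2) (1 : DirichletCharacter ℂ (N * 8 ^ 2)) := by
  have h := classProj_mem_halfIntModularForms_of_mem hN hg c
  rwa [DirichletCharacter.changeLevel_one] at h

end Summit.BirchSwinnertonDyer.BirchSwinnertonDyer.Theorems.PrintCFram.FlipRung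

end
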